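import Summits.Ventures.CertifiedManyBodySolver.Observables.PinningFieldChords
import HarnessLib

/-!
# DOWNWARD field transport through the TWO-SIDED response node: a sourced-energy CAP and a response
# CEILING at one field `h₂` give a sourced-energy cap — hence Hellmann–Feynman chord FLOORS — at every
# smaller field `h ≤ h₂`; the REACH LAW of a two-sided window

HONEST FRAMING: finite-field RESPONSE floors/ceilings (certified once the input rows are); never an order
parameter, never a phase word, no `h → 0` content; not a superconductivity verdict; every number certified or
labelled float. Nothing in this file is a number: soundness edges and slot arithmetic only; zero compute.

Cell hubbard-cq (LADDER rung CQ, row PC-a «pinning-field response»; D-0082 (c)), seat hubbard-cq-obsth-3, row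
«Hellmann–Feynman bracket → m_d(h) two-sided node». Companion of `PinningFieldChords.lean` (hubbard-obs-pin-1:
rows at two fields ⇒ one response leaf; §3 there: a cap transported UP in field by monotonicity never gives a
floor, `floorSlot_nonpos_of_transported_cap`), of hubbard-cq-obsth-2's UPWARD transport of floors
(`PinFieldResponseFloorAt.mono_field`, `IsTorusLimitOf.re_expect_localPairAt_mono`: a floor certified at `h` holds
at every `h' ≥ h`) and of hubbard-cq-obsth-1's one-point certificate consumers, whose MAX programs conclude exactly
the ceiling leaf `PinFieldResponseCeilingAt tp U μ h₂ q L₀ M` consumed here (`Rows/SourcedTorusRowsOnePointKKT*.lean`).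

THE LEVER (Koma–Tasaki's sandwich read at the larger field; Griffiths' tangent line of a concave function lies
above its graph). On one torus, the tracial ground state of `A_L(h₂) = H − μN − h₂(Δ_d + Δ_d†)` is a trial state at
every field `h`, and its energy there is AFFINE in `h` with slope `−2L²·m_L(h₂)`:
`E_L(h) ≤ E_L(h₂) + 2(h₂ − h)·L²·m_L(h₂)` (`dWaveSourceDensityTT'_mul_le_groundEnergy_drop`, all real `h, h₂`).
For `h ≤ h₂` the coefficient `h₂ − h` is `≥ 0`, so a certified cap `E_L(h₂) ≤ hi₂·L²` AND a certified response
CEILING `m_L(h₂) ≤ M₂` at the SAME field give the TRANSPORTED CAP `E_L(h) ≤ (hi₂ + 2(h₂ − h)M₂)·L²` at every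
`h ≤ h₂` (§1–§2; ℚ-slot row `SourcedEnergyUpperRow tp U μ h q L₀ e` for any rational `e ≥ hi₂ + 2(h₂−h)M₂`, which
every existing reader of the cell consumes verbatim: `PinFieldResponseFloorAt.of_energyRows`,
`SourcedEnergyLowerRow.chordFloor_{isMeanEnergyMinimiser, liminf, torusLimit}`, …). With a floor cell `lo·L² ≤ E_L(h₁)`
at a field `h₁ < h` (today: `h₁ = 0`, a TL / GC lower of record) the left chord then FLOORS the response at the
smaller field: `m_L(h) ≥ (lo − hi₂ − 2(h₂ − h)M₂)/(2(h − h₁))` — the only mechanism on file by which a CEILING (the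
ABSENT-side one-point instrument of branch (c-1), applied at finite field) buys REACH toward smaller fields for the
PRESENT-side floors. This file is the FINITE-TORUS / ROW layer (§1 one torus, §2 uniform rows and leaves, §3 the
reach law); the thermodynamic-limit forms (grand-canonical translation-invariant ground states at `(μ, h)`, torus-limit
ground states, the stair `liminf_L m_{L+1}`, and cq-p2's CANONICAL fixed-density class) are the sequel
`PinningFieldCapTransportDownTL.lean`.

REACH LAW (§3, pure arithmetic). Write `c₂ := (lo − hi₂)/(2(h₂ − h₁))` for the chord floor the same two energy rows
give AT `h₂`. The transported slot `lo − hi₂ − 2(h₂ − h)M₂` is positive iff `h > h₂ − (lo − hi₂)/(2M₂)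
= h₂ − (h₂ − h₁)·c₂/M₂` (`transportedSlot_pos_iff[_chord]`): a two-sided window `[c₂, M₂]` at `h₂` floors the response
on the interval `(h₂ − (h₂ − h₁)c₂/M₂, h₂]`, of relative length `c₂/M₂` = the TIGHTNESS of the window; and the
transported floor never exceeds `c₂` when `M₂ ≥ c₂` (`transportedFloor_le_chord`; consistent with `m` non-decreasing —
it is a genuinely new, weaker floor at a smaller field, not an improvement at `h₂`). `M₂ = c₂` (a window tight
against the chord from `h₁ = 0`) would mean `m` constant on `(0, h₂]`, i.e. `m⋆ = c₂ > 0`: reach to `h → 0⁺` IS the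
order question (obstruction O2 of the cell, in numbers), and this file claims nothing there.

TODAY'S NUMBERS [arithmetic on CANDIDATE inputs; planning, not theorems; tree units h_tree = √2·g]. A0′ = (8, 7/8, 0),
canonical class: the two-sided bracket of record at `h₂ = √2·2/7 = 0.40406` is `[c₂, M₂] = [0.0882348, 1.0829965]`
(§B1-U chord floor on `#473` + job-U2 cap `u = −0.9085368`; pilot-1 job D one-point ceiling `M5`, CQ-TABLE A13–A14)
⇒ reach threshold `0.40406·(1 − 0.0882348/1.0829965) = 0.37114`: no menu field lies in `(0.37114, 0.40406]`, so no
new floor today. Ceiling quality that WOULD transport the 2/7 rows down to `g = 1/4` (`h = 0.35355`):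
`M₂ ≤ 0.0713045/(2·0.05051) = 0.7058`; down to `g = 3/14` (`h = 0.30305`, the first print-comparable field, no
canonical floor of record): `M₂(0.40406) ≤ 0.3529`, or from the 3/7 rows (`c = 0.2452147`, margin `0.2972451`)
`M(0.60609) ≤ 0.4904`, or from the 4/7 rows (`c = 0.3422124`, margin `0.5530987`) `M(0.80812) ≤ 0.5475` — versus the
cap states' own responses ≳ 0.63 / 0.67 / 0.72 [float, left secants of the U2 cluster `eps` column], which bound
from below every ceiling certified over an energy-capped class containing them: within the energy-window one-point class
the downward lever cannot reach `0.303` from today's fields; a ceiling certified over a class the cluster product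
states do NOT belong to (minimiser-only rows: KKT / stationarity, card `sourced-kkt-one-point-floor`) is the input
that could. Sanity example of the lever with NO certificate at all: the kinematic ceiling `m_L ≤ 4√2`-type bound is
useless, but ANY certified `M(0.80812) < 1.369` already transports the 4/7 cap to a positive floor at `0.60609`.

No definition, no named fact, no `sorry`.

References: T. Koma, H. Tasaki, J. Stat. Phys. 76 (1994) 745, §1 (energy concave in the source; the sandwich)
[cite: KomaTasaki1994, §1]; R. B. Griffiths, J. Math. Phys. 5 (1964) 1215, §II and Phys. Rev. 152 (1966) 240, §II
(tangent / secant bounds of a concave thermodynamic function and its conjugate one-point function)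
[cite: Griffiths1964, §II] [cite: Griffiths1966, §II]; O. Bratteli, A. Kishimoto, D. W. Robinson, CMP 64 (1978) 41,
Thm. 2 (translation-invariant ground states = mean-energy minimisers) [cite: BratteliKishimotoRobinson1978, Thm. 2].
-/

noncomputable section

namespace Summit.Ventures.CertifiedManyBodySolver

open Literature.MathematicalPhysics.QuantumLattice Literature.Probability.LatticeModels HubbardWave0 _root_.Matrix
open Summit.Ventures.CertifiedManyBodySolver.Observables

/-! ## §1  One torus: the transported cap and the transported chord floor -/

section OneTorus

variable {L : ℕ} [NeZero L] {tp U μ : ℝ}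

/-- **Transported CAP, one torus, real form.** For `h ≤ h₂` and any `M ≥ m_L(h₂)`:
`E_L(h) ≤ E_L(h₂) + 2(h₂ − h)·M·L²` — the tracial ground state of `A_L(h₂)` is a trial state at `h`, its energy
affine in `h` with slope `−2L²m_L(h₂)` (`dWaveSourceDensityTT'_mul_le_groundEnergy_drop`). [cite: KomaTasaki1994, §1] -/
theorem groundEnergy_dWaveSourceTorusTT'_le_transportDown (L : ℕ) [NeZero L] (tp U μ : ℝ) {h h₂ : ℝ}
    (hle : h ≤ h₂) {M : ℝ} (hM : dWaveSourceDensityTT' L tp U μ h₂ ≤ M) :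
    (dWaveSourceTorusTT' L tp U μ h).groundEnergy ≤
      (dWaveSourceTorusTT' L tp U μ h₂).groundEnergy + 2 * (h₂ - h) * M * (L : ℝ) ^ 2 := by
  have h1 := dWaveSourceDensityTT'_mul_le_groundEnergy_drop (L := L) tp U μ h₂ h
  have hL : (0 : ℝ) ≤ (L : ℝ) ^ 2 := by positivity
  have h2 : (h₂ - h) * ((L : ℝ) ^ 2 * dWaveSourceDensityTT' L tp U μ h₂) ≤ (h₂ - h) * ((L : ℝ) ^ 2 * M) :=
    mul_le_mul_of_nonneg_left (mul_le_mul_of_nonneg_left hM hL) (sub_nonneg.2 hle)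
  nlinarith [h1, h2]

/-- **Transported CAP, one torus, row form**: a cap cell `hi` at `h₂`, a response-ceiling cell `M` at `h₂`, `h ≤ h₂`
and a rational slot `e ≥ hi + 2(h₂ − h)M` give the cap cell `e` at `h`. [cite: KomaTasaki1994, §1] -/
theorem SourcedTorusEnergyUpperRow.transportDown {h h₂ : ℝ} (hle : h ≤ h₂) {hi M e : ℚ}
    (hhi : SourcedTorusEnergyUpperRow L tp U μ h₂ hi) (hM : PinFieldTorusResponseCeiling L tp U μ h₂ M)
    (he : ((hi : ℚ) : ℝ) + 2 * (h₂ - h) * ((M : ℚ) : ℝ) ≤ ((e : ℚ) : ℝ)) :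
    SourcedTorusEnergyUpperRow L tp U μ h e := by
  have hhi' := sourcedTorusEnergyUpperRow_iff.1 hhi
  unfold PinFieldTorusResponseCeiling at hM
  rw [sourcedTorusEnergyUpperRow_iff]
  have h1 := groundEnergy_dWaveSourceTorusTT'_le_transportDown L tp U μ hle hM
  have hL : (0 : ℝ) ≤ (L : ℝ) ^ 2 := by positivity
  have h3 := mul_le_mul_of_nonneg_right he hL
  nlinarith [h1, hhi', h3]

/-- **Transported chord FLOOR, one torus**: a floor cell `lo` at `h₁ < h`, a cap cell `hi` and a response-ceiling cell
`M` at `h₂ ≥ h`, and a rational slot `m` with `m·2(h − h₁) + 2(h₂ − h)·M ≤ lo − hi` give `m ≤ m_L(h)`. Teeth iff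
`h > h₂ − (lo − hi)/(2M)` (§3). [cite: KomaTasaki1994, §1] [cite: Griffiths1966, §II] -/
theorem PinFieldTorusResponseFloor.of_lowerRow_of_capCeiling {h₁ h h₂ : ℝ} (hlt : h₁ < h) (hle : h ≤ h₂)
    {lo hi M m : ℚ} (hlo : SourcedTorusEnergyLowerRow L tp U μ h₁ lo) (hhi : SourcedTorusEnergyUpperRow L tp U μ h₂ hi)
    (hM : PinFieldTorusResponseCeiling L tp U μ h₂ M)
    (hm : ((m : ℚ) : ℝ) * (2 * (h - h₁)) + 2 * (h₂ - h) * ((M : ℚ) : ℝ) ≤ ((lo : ℚ) : ℝ) - ((hi : ℚ) : ℝ)) :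
    PinFieldTorusResponseFloor L tp U μ h m := by
  have hlo' := sourcedTorusEnergyLowerRow_iff.1 hlo
  have hhi' := sourcedTorusEnergyUpperRow_iff.1 hhi
  unfold PinFieldTorusResponseCeiling at hM
  unfold PinFieldTorusResponseFloor
  have hcap := groundEnergy_dWaveSourceTorusTT'_le_transportDown L tp U μ hle hM
  have hsand := dWaveSourceDensityTT'_mul_le_groundEnergy_drop (L := L) tp U μ h h₁
  have hL := cast_sq_pos_of_neZero L
  have hδ : 0 < h - h₁ := sub_pos.2 hlt
  have hmL := mul_le_mul_of_nonneg_right hm hL.le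
  have key : ((m : ℚ) : ℝ) * ((2 * (h - h₁)) * (L : ℝ) ^ 2) ≤
      dWaveSourceDensityTT' L tp U μ h * ((2 * (h - h₁)) * (L : ℝ) ^ 2) := by
    nlinarith [hsand, hcap, hlo', hhi', hmL]
  exact le_of_mul_le_mul_right key (by positivity)

end OneTorus

/-! ## §2  Uniform rows: the transported cap row and the transported floor leaf on a side progression -/

section Rows

variable {tp U μ : ℝ} {q L₀ L₀' L₁ : ℕ}

/-- **Transported CAP ROW**: `SourcedEnergyUpperRow tp U μ h₂ q L₀ hi` and the ceiling leaf
`PinFieldResponseCeilingAt tp U μ h₂ q L₀' M` at the SAME field `h₂`, `h ≤ h₂`, and a rational `e ≥ hi + 2(h₂ − h)M` give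
`SourcedEnergyUpperRow tp U μ h q (max L₀ L₀') e` — a cap row at the SMALLER field, consumable by every reader of the
cell (`PinFieldResponseFloorAt.of_energyRows`, `SourcedEnergyLowerRow.chordFloor_*`, `…responseFloor_*_of_slot`). Rows on
different progressions are first brought to a common one with `.mono`. [cite: KomaTasaki1994, §1] -/
theorem SourcedEnergyUpperRow.transportDown {h h₂ : ℝ} (hle : h ≤ h₂) {hi M e : ℚ}
    (hhi : SourcedEnergyUpperRow tp U μ h₂ q L₀ hi) (hM : PinFieldResponseCeilingAt tp U μ h₂ q L₀' M)
    (he : ((hi : ℚ) : ℝ) + 2 * (h₂ - h) * ((M : ℚ) : ℝ) ≤ ((e : ℚ) : ℝ)) :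
    SourcedEnergyUpperRow tp U μ h q (max L₀ L₀') e :=
  fun L _ hL hqL => SourcedTorusEnergyUpperRow.transportDown hle (hhi L ((le_max_left _ _).trans hL) hqL)
    (hM L ((le_max_right _ _).trans hL) hqL) he

/-- **Transported FLOOR LEAF**: a floor row `lo` at `h₁ < h`, a cap row `hi` and a ceiling leaf `M` at `h₂ ≥ h` (one
progression `q`), and a rational slot `m` with `m·2(h − h₁) + 2(h₂ − h)M ≤ lo − hi` give
`PinFieldResponseFloorAt tp U μ h q (max L₁ (max L₀ L₀')) m`. [cite: KomaTasaki1994, §1] [cite: Griffiths1966, §II] -/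
theorem PinFieldResponseFloorAt.of_lowerRow_of_capCeiling {h₁ h h₂ : ℝ} (hlt : h₁ < h) (hle : h ≤ h₂)
    {lo hi M m : ℚ} (hlo : SourcedEnergyLowerRow tp U μ h₁ q L₁ lo) (hhi : SourcedEnergyUpperRow tp U μ h₂ q L₀ hi)
    (hM : PinFieldResponseCeilingAt tp U μ h₂ q L₀' M)
    (hm : ((m : ℚ) : ℝ) * (2 * (h - h₁)) + 2 * (h₂ - h) * ((M : ℚ) : ℝ) ≤ ((lo : ℚ) : ℝ) - ((hi : ℚ) : ℝ)) :
    PinFieldResponseFloorAt tp U μ h q (max L₁ (max L₀ L₀')) m :=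
  fun L _ hL hqL => PinFieldTorusResponseFloor.of_lowerRow_of_capCeiling hlt hle
    (hlo L ((le_max_left _ _).trans hL) hqL)
    (hhi L ((le_max_left _ _).trans ((le_max_right _ _).trans hL)) hqL)
    (hM L ((le_max_right _ _).trans ((le_max_right _ _).trans hL)) hqL) hm

/-- **From a two-sided WINDOW leaf at `h₂`** (`PinFieldResponseWindowAt … h₂ q L₀' m₂ M`, only its ceiling half is
used) plus the two energy rows that produced it: the floor leaf at every `h ∈ (h₁, h₂]` whose slot closes.
[cite: KomaTasaki1994, §1] -/
theorem PinFieldResponseWindowAt.floorAt_below {h₁ h h₂ : ℝ} (hlt : h₁ < h) (hle : h ≤ h₂)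
    {lo hi m₂ M m : ℚ} (hW : PinFieldResponseWindowAt tp U μ h₂ q L₀' m₂ M)
    (hlo : SourcedEnergyLowerRow tp U μ h₁ q L₁ lo) (hhi : SourcedEnergyUpperRow tp U μ h₂ q L₀ hi)
    (hm : ((m : ℚ) : ℝ) * (2 * (h - h₁)) + 2 * (h₂ - h) * ((M : ℚ) : ℝ) ≤ ((lo : ℚ) : ℝ) - ((hi : ℚ) : ℝ)) :
    PinFieldResponseFloorAt tp U μ h q (max L₁ (max L₀ L₀')) m :=
  PinFieldResponseFloorAt.of_lowerRow_of_capCeiling hlt hle hlo hhi hW.2 hm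

end Rows

/-! ## §3  The REACH LAW of a two-sided window (slot arithmetic over `ℝ`) -/

section Reach

/-- **Teeth of the transported slot**: for `M > 0`, `0 < lo − hi − 2(h₂ − h)M ↔ h₂ − (lo − hi)/(2M) < h`.
[folklore] -/
theorem transportedSlot_pos_iff {h h₂ lo hi M : ℝ} (hM : 0 < M) :
    0 < lo - hi - 2 * (h₂ - h) * M ↔ h₂ - (lo - hi) / (2 * M) < h := by
  rw [sub_lt_comm, lt_div_iff₀ (by positivity : (0 : ℝ) < 2 * M)]
  constructor <;> intro H <;> nlinarith [H]

/-- **Reach law in chord form**: with `c₂ := (lo − hi)/(2(h₂ − h₁))` the chord floor AT `h₂` from the same two rows,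
the transported slot has teeth iff `h > h₂ − (h₂ − h₁)·c₂/M` — a window `[c₂, M]` at `h₂` reaches down over a
fraction `c₂/M` of `[h₁, h₂]`. [folklore] -/
theorem transportedSlot_pos_iff_chord {h₁ h h₂ lo hi M : ℝ} (hlt : h₁ < h₂) (hM : 0 < M) :
    0 < lo - hi - 2 * (h₂ - h) * M ↔ h₂ - (h₂ - h₁) * ((lo - hi) / (2 * (h₂ - h₁))) / M < h := by
  have hδ : (h₂ - h₁) ≠ 0 := (sub_pos.2 hlt).ne'
  have e : (h₂ - h₁) * ((lo - hi) / (2 * (h₂ - h₁))) / M = (lo - hi) / (2 * M) := by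
    field_simp
  rw [e]
  exact transportedSlot_pos_iff hM

/-- **Honesty of the transported floor**: if the ceiling is at least the chord floor at `h₂` (`c₂ ≤ M`, as for any
ceiling on a state class containing the `h₂` minimisers), the transported floor at `h ∈ (h₁, h₂]` never exceeds `c₂`:
`(lo − hi − 2(h₂ − h)M)/(2(h − h₁)) ≤ (lo − hi)/(2(h₂ − h₁))` — consistent with `m` non-decreasing in the field; a new,
weaker floor at a smaller field, never a sharpening at `h₂`. [folklore] -/
theorem transportedFloor_le_chord {h₁ h h₂ lo hi M : ℝ} (hlt : h₁ < h) (hle : h ≤ h₂)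
    (hMc : (lo - hi) / (2 * (h₂ - h₁)) ≤ M) :
    (lo - hi - 2 * (h₂ - h) * M) / (2 * (h - h₁)) ≤ (lo - hi) / (2 * (h₂ - h₁)) := by
  have hδ₂ : 0 < h₂ - h₁ := by linarith
  set c := (lo - hi) / (2 * (h₂ - h₁)) with hc
  have hlohi : lo - hi = 2 * (h₂ - h₁) * c := by
    rw [hc]; field_simp
  rw [div_le_iff₀ (by linarith : (0 : ℝ) < 2 * (h - h₁)), hlohi]
  have h1 := mul_le_mul_of_nonneg_left hMc (by linarith : (0 : ℝ) ≤ 2 * (h₂ - h))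
  nlinarith [h1]

/-- **Reach toward `h₁`** (the order question in numbers): the transported slot is positive at EVERY `h ∈ (h₁, h₂]` only
if `M·(h₂ − h₁) ≤ (lo − hi)/2`, i.e. `M ≤ c₂` — the window must be tight against the chord from `h₁`. [folklore] -/
theorem ceiling_le_chord_of_forall_transportedSlot_pos {h₁ h₂ lo hi M : ℝ} (hlt : h₁ < h₂)
    (hall : ∀ h, h₁ < h → h ≤ h₂ → 0 ≤ lo - hi - 2 * (h₂ - h) * M) :
    M ≤ (lo - hi) / (2 * (h₂ - h₁)) := by
  have hδ : 0 < h₂ - h₁ := sub_pos.2 hlt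
  rw [le_div_iff₀ (by positivity)]
  by_contra hcon
  rw [not_le] at hcon
  -- `M ≤ 0`: the slot at `h = h₂` already gives it; `M > 0`: read the slot at `h = h₁ + ε`, `ε` small
  rcases le_or_gt M 0 with hM0 | hMpos
  · have := hall h₂ hlt le_rfl
    nlinarith
  · set gap := M * (2 * (h₂ - h₁)) - (lo - hi) with hgap
    have hgap_pos : 0 < gap := by rw [hgap]; linarith
    set ε := min ((h₂ - h₁) / 2) (gap / (4 * M)) with hε
    have hεpos : 0 < ε := lt_min (by positivity) (by positivity)
    have hεle : ε ≤ (h₂ - h₁) / 2 := min_le_left _ _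
    have hεle' : ε ≤ gap / (4 * M) := min_le_right _ _
    have hh := hall (h₁ + ε) (by linarith) (by linarith)
    have h4 : ε * (4 * M) ≤ gap := by rwa [le_div_iff₀ (by positivity)] at hεle'
    nlinarith [hh, h4, hMpos, hεpos]

end Reach

/-! ## §4  The same inequality read as a FLOOR ROW at the LARGER field (appended 2026-08-27, hubbard-cq-obsth-3 g4):
a floor `lo₁` at `h₁ ≤ h₂` and a response ceiling `M` at `h₂` give the sourced-energy floor `lo₁ − 2(h₂ − h₁)M` AT `h₂` —
the certified sharpening of the Lipschitz transport `e(h₂) ≥ e(h₁) − 2B(h₂ − h₁)` (`B` kinematic) of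
`DWaveSourceEnergyDensityTransport` §3; sourced floor rows at `h > 0` are the scarce input of every chord CEILING -/

section LowerUp

variable {L : ℕ} [NeZero L] {tp U μ : ℝ} {q L₀ L₀' : ℕ}

/-- **Transported FLOOR, one torus, row form**: a floor cell `lo` at `h₁`, a response-ceiling cell `M` at `h₂ ≥ h₁`, and a
rational slot `e ≤ lo − 2(h₂ − h₁)M` give the floor cell `e` AT `h₂` (`E_L(h₁) ≤ E_L(h₂) + 2(h₂ − h₁)M·L²` rearranged).
[cite: KomaTasaki1994, §1] -/
theorem SourcedTorusEnergyLowerRow.transportUp_of_ceiling {h₁ h₂ : ℝ} (hle : h₁ ≤ h₂) {lo M e : ℚ}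
    (hlo : SourcedTorusEnergyLowerRow L tp U μ h₁ lo) (hM : PinFieldTorusResponseCeiling L tp U μ h₂ M)
    (he : ((e : ℚ) : ℝ) ≤ ((lo : ℚ) : ℝ) - 2 * (h₂ - h₁) * ((M : ℚ) : ℝ)) :
    SourcedTorusEnergyLowerRow L tp U μ h₂ e := by
  have hlo' := sourcedTorusEnergyLowerRow_iff.1 hlo
  unfold PinFieldTorusResponseCeiling at hM
  rw [sourcedTorusEnergyLowerRow_iff]
  have h1 := groundEnergy_dWaveSourceTorusTT'_le_transportDown L tp U μ hle hM
  have hL : (0 : ℝ) ≤ (L : ℝ) ^ 2 := by positivity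
  have h3 := mul_le_mul_of_nonneg_right he hL
  nlinarith [h1, hlo', h3]

/-- **Transported FLOOR ROW at the larger field**: `SourcedEnergyLowerRow tp U μ h₁ q L₀ lo`, the ceiling leaf
`PinFieldResponseCeilingAt tp U μ h₂ q L₀' M`, `h₁ ≤ h₂` and `e ≤ lo − 2(h₂ − h₁)M` give `SourcedEnergyLowerRow tp U μ h₂ q (max L₀ L₀') e`
— a sourced floor row AT `h₂ > 0` (the input of `PinFieldResponseCeilingAt.of_energyRows` at fields below `h₂`), certified
from an `h = 0` floor and a one-point ceiling. [cite: KomaTasaki1994, §1] -/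
theorem SourcedEnergyLowerRow.transportUp_of_ceiling {h₁ h₂ : ℝ} (hle : h₁ ≤ h₂) {lo M e : ℚ}
    (hlo : SourcedEnergyLowerRow tp U μ h₁ q L₀ lo) (hM : PinFieldResponseCeilingAt tp U μ h₂ q L₀' M)
    (he : ((e : ℚ) : ℝ) ≤ ((lo : ℚ) : ℝ) - 2 * (h₂ - h₁) * ((M : ℚ) : ℝ)) :
    SourcedEnergyLowerRow tp U μ h₂ q (max L₀ L₀') e :=
  fun L _ hL hqL => SourcedTorusEnergyLowerRow.transportUp_of_ceiling hle (hlo L ((le_max_left _ _).trans hL) hqL)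
    (hM L ((le_max_right _ _).trans hL) hqL) he

/-- **FLOOR at a LARGER field `h > h₂` from the transported floor** (one torus): floor `lo` at `h₁ ≤ h₂`, ceiling `M` at `h₂`,
cap `hi` AT `h > h₂`, and a rational slot `m` with `m·2(h − h₂) + 2(h₂ − h₁)M ≤ lo − hi` give `m ≤ m_L(h)` — the left chord
between the transported floor at `h₂` and the cap at `h`. HONEST COMPARISON: against the direct chord from `h₁`
(`PinFieldTorusResponseFloor.of_energyRows`, floor `c₁ = (lo − hi)/(2(h − h₁))`) this wins iff `c₁ > M`, i.e. iff the
ceiling certified at the SMALL field `h₂` lies BELOW the chord floor at the large field `h` — a certified small response at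
small field sharpens the large-field floors (the ABSENT-side instrument feeding the PRESENT-side rows upward; today every
certified ceiling exceeds every certified floor, so no instance has teeth yet). [cite: KomaTasaki1994, §1] [cite: Griffiths1966, §II] -/
theorem PinFieldTorusResponseFloor.of_transportedFloor_of_cap {h₁ h₂ h : ℝ} (hle : h₁ ≤ h₂) (hlt : h₂ < h)
    {lo hi M m : ℚ} (hlo : SourcedTorusEnergyLowerRow L tp U μ h₁ lo) (hM : PinFieldTorusResponseCeiling L tp U μ h₂ M)
    (hhi : SourcedTorusEnergyUpperRow L tp U μ h hi)
    (hm : ((m : ℚ) : ℝ) * (2 * (h - h₂)) + 2 * (h₂ - h₁) * ((M : ℚ) : ℝ) ≤ ((lo : ℚ) : ℝ) - ((hi : ℚ) : ℝ)) :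
    PinFieldTorusResponseFloor L tp U μ h m := by
  have hlo' := sourcedTorusEnergyLowerRow_iff.1 hlo
  have hhi' := sourcedTorusEnergyUpperRow_iff.1 hhi
  unfold PinFieldTorusResponseCeiling at hM
  unfold PinFieldTorusResponseFloor
  have hcap := groundEnergy_dWaveSourceTorusTT'_le_transportDown L tp U μ hle hM
  have hsand := dWaveSourceDensityTT'_mul_le_groundEnergy_drop (L := L) tp U μ h h₂
  have hL := cast_sq_pos_of_neZero L
  have hδ : 0 < h - h₂ := sub_pos.2 hlt
  have hmL := mul_le_mul_of_nonneg_right hm hL.le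
  have key : ((m : ℚ) : ℝ) * ((2 * (h - h₂)) * (L : ℝ) ^ 2) ≤
      dWaveSourceDensityTT' L tp U μ h * ((2 * (h - h₂)) * (L : ℝ) ^ 2) := by
    nlinarith [hsand, hcap, hlo', hhi', hmL]
  exact le_of_mul_le_mul_right key (by positivity)

/-- **FLOOR LEAF at a larger field from the transported floor** (uniform rows, one progression): floor row `lo` at `h₁ ≤ h₂`,
ceiling leaf `M` at `h₂`, cap row `hi` at `h > h₂`, slot `m·2(h − h₂) + 2(h₂ − h₁)M ≤ lo − hi` ⇒
`PinFieldResponseFloorAt tp U μ h q (max L₀ (max L₀' L₁)) m`. Wins against the direct chord from `h₁` iff `M < (lo − hi)/(2(h − h₁))`.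
[cite: KomaTasaki1994, §1] -/
theorem PinFieldResponseFloorAt.of_transportedFloor_of_cap {h₁ h₂ h : ℝ} (hle : h₁ ≤ h₂) (hlt : h₂ < h)
    {lo hi M m : ℚ} {L₁ : ℕ} (hlo : SourcedEnergyLowerRow tp U μ h₁ q L₀ lo)
    (hM : PinFieldResponseCeilingAt tp U μ h₂ q L₀' M) (hhi : SourcedEnergyUpperRow tp U μ h q L₁ hi)
    (hm : ((m : ℚ) : ℝ) * (2 * (h - h₂)) + 2 * (h₂ - h₁) * ((M : ℚ) : ℝ) ≤ ((lo : ℚ) : ℝ) - ((hi : ℚ) : ℝ)) :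
    PinFieldResponseFloorAt tp U μ h q (max L₀ (max L₀' L₁)) m :=
  fun L _ hL hqL => PinFieldTorusResponseFloor.of_transportedFloor_of_cap hle hlt
    (hlo L ((le_max_left _ _).trans hL) hqL)
    (hM L ((le_max_left _ _).trans ((le_max_right _ _).trans hL)) hqL)
    (hhi L ((le_max_right _ _).trans ((le_max_right _ _).trans hL)) hqL) hm

/-- **When does the small-field ceiling pay?** (slot arithmetic): the transported-floor chord at `h` beats the direct chord from
`h₁` — `(lo − hi − 2(h₂ − h₁)M)/(2(h − h₂)) > (lo − hi)/(2(h − h₁))` — iff `M < (lo − hi)/(2(h − h₁))`, the direct chord floor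
itself (`h₁ < h₂ < h`). [folklore] -/
theorem transportedFloorChord_gt_directChord_iff {h₁ h₂ h lo hi M : ℝ} (hlt₁ : h₁ < h₂) (hlt₂ : h₂ < h) :
    (lo - hi) / (2 * (h - h₁)) < (lo - hi - 2 * (h₂ - h₁) * M) / (2 * (h - h₂)) ↔
      M < (lo - hi) / (2 * (h - h₁)) := by
  have hδ₁ : 0 < h - h₁ := by linarith
  have hδ₂ : 0 < h - h₂ := by linarith
  have hΔ : 0 < h₂ - h₁ := by linarith
  rw [div_lt_div_iff₀ (by positivity) (by positivity), lt_div_iff₀ (by positivity)]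
  constructor
  · intro H
    nlinarith [H, hδ₁, hδ₂, hΔ]
  · intro H
    nlinarith [H, hδ₁, hδ₂, hΔ, mul_pos hΔ hδ₁]

end LowerUp

end Summit.Ventures.CertifiedManyBodySolver

end
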